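import Summits.CriticalPhenomena.Ising3D.TaylorHalfStripPos
import Mathlib.Tactic.Linarith
import Mathlib.Tactic.Positivity
import Mathlib.Tactic.Ring
import HarnessLib

/-!
# Half-strip positivity checker, version 2: Taylor-shift sign test for the unbounded part
(cell `pub-ising3x`, seat recog-1 gen 11; gate (g2) — replaces the Cauchy bound of `halfStripPos`, which is far too
crude for real Λ = 11 tables (MEASURED: columns alternate in sign with magnitude ratios ≈ 70 per degree, so the
Cauchy switch point would be ≈ 10⁸); here the unbounded part is decided per θ-cell by shifting the `P`-polynomial
to `P₁` and checking the signs of the shifted interval coefficients)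

HONEST FRAMING: lottery ticket; floor = tightest certified 3D Ising CFT bounds; no exact-solution
claim without a proof.

`halfStripPos2 S H P₀ ⟨θhi, P₁, nθ, dP⟩`: for each of the `nθ` uniform cells of `[0, θhi]` the columns of `H` are
enclosed (`colEncl`), giving an interval polynomial in `P`; (U) its Taylor shift to `P₁` (`shiftI`) must have a
positive constant coefficient and non-negative higher coefficients (lower ends) ⇒ `G > 0` for `P ≥ P₁`;
(B) `posOn` on `[P₀, P₁]` (skipped if `P₁ ≤ P₀`). **`halfStripPos2_sound`**: same statement as `halfStripPos_sound`.
Elementary (Moore 1966 Ch. 3). [folklore]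
-/

namespace Summit.CriticalPhenomena.Ising3D

open Finset
open Literature.Analysis.ValidatedNumerics Literature.Analysis.ValidatedNumerics.PolyMP
open Literature.Analysis.ValidatedNumerics.NumericsMP (MI)

/-! ### Sign test on an interval polynomial -/

/-- All lower ends non-negative. [folklore] -/
def allLoNonneg (P : IPoly) : Bool := P.all fun I => decide (0 ≤ I.lo)

/-- [folklore] -/
theorem evalR_nonneg_of_allLoNonneg {S : ℕ} (hS : 0 < S) : ∀ {as : List ℝ} {P : IPoly}, PMem S as P →
    allLoNonneg P = true → ∀ {y : ℝ}, 0 ≤ y → 0 ≤ evalR as y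
  | _, _, List.Forall₂.nil, _, y, _ => le_rfl
  | _, _, List.Forall₂.cons (a := a) (b := I) ha hP, h, y, hy => by
      simp only [allLoNonneg, List.all_cons, Bool.and_eq_true, decide_eq_true_eq] at h
      have ha0 : 0 ≤ a := by
        have h1 : (I.lo : ℝ) ≤ a * S := ha.1
        have h2 : (0 : ℝ) ≤ I.lo := by exact_mod_cast h.1
        have hSpos : (0 : ℝ) < S := by exact_mod_cast hS
        nlinarith
      have ih := evalR_nonneg_of_allLoNonneg hS hP (by simpa [allLoNonneg] using h.2) hy
      rw [evalR_cons]
      positivity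

/-- Positive constant coefficient and non-negative rest. [folklore] -/
def posLead (P : IPoly) : Bool :=
  match P with
  | [] => false
  | I :: rest => decide (0 < I.lo) && allLoNonneg rest

/-- [folklore] -/
theorem evalR_pos_of_posLead {S : ℕ} (hS : 0 < S) {as : List ℝ} {P : IPoly} (h : PMem S as P)
    (hc : posLead P = true) {y : ℝ} (hy : 0 ≤ y) : 0 < evalR as y := by
  match as, P, h with
  | [], [], _ => simp [posLead] at hc
  | a :: as, I :: rest, List.Forall₂.cons ha hP =>
    simp only [posLead, Bool.and_eq_true, decide_eq_true_eq] at hc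
    have ha0 : 0 < a := by
      have h1 : (I.lo : ℝ) ≤ a * S := ha.1
      have h2 : (0 : ℝ) < I.lo := by exact_mod_cast hc.1
      have hSpos : (0 : ℝ) < S := by exact_mod_cast hS
      nlinarith
    have hrest := evalR_nonneg_of_allLoNonneg hS hP hc.2 hy
    rw [evalR_cons]
    positivity

/-! ### The checker -/

/-- Per θ-cell test: tail by the shifted-sign test at `P₁`, box part by `posOn` on `[P₀, P₁]`. [folklore] -/
def cellOK (S : ℕ) (H : IPoly2) (M : ℕ) (P0 P1 c h : ℚ) (dP : ℕ) : Bool :=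
  posLead (shiftI S (colEncl S H M c h) (PolyMP.ofRat S P1)) &&
    (decide (P1 ≤ P0) || posOn S dP (colEncl S H M c h) P0 P1)

/-- **Half-strip checker v2** (module docstring). [folklore] -/
def halfStripPos2 (S : ℕ) (H : IPoly2) (P0 : ℚ) (prm : HSParams) : Bool :=
  decide (0 < prm.θhi) && decide (0 < prm.nθ) &&
    (List.range prm.nθ).all fun k =>
      cellOK S H (effCols H (rowMax2I H)) P0 prm.P1
        (prm.θhi * (2 * (k : ℚ) + 1) / (2 * (prm.nθ : ℚ))) (prm.θhi / (2 * (prm.nθ : ℚ))) prm.dP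

/-- **Soundness of the v2 checker.** [folklore] -/
theorem halfStripPos2_sound {S : ℕ} (hS : 0 < S) {G : List (List ℝ)} {H : IPoly2} (hG : PMem2 S G H)
    {P0 : ℚ} {prm : HSParams} (h : halfStripPos2 S H P0 prm = true) {P θ : ℝ} (hP : (P0 : ℝ) ≤ P)
    (hθ0 : 0 ≤ θ) (hθ1 : θ ≤ prm.θhi) : 0 < eval2 G P θ := by
  have hsz : rowMax2 G ≤ rowMax2I H := (rowMax2_eq_of_pmem2 hG).le
  simp only [halfStripPos2, Bool.and_eq_true, decide_eq_true_eq] at h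
  obtain ⟨⟨hη, hn⟩, hall⟩ := h
  set M := effCols H (rowMax2I H) with hM
  -- locate the θ-cell
  have hnR : (0 : ℝ) < prm.nθ := by exact_mod_cast hn
  have hn1 : prm.nθ - 1 + 1 = prm.nθ := Nat.sub_add_cancel hn
  obtain ⟨k, hk, hk1, hk2⟩ := exists_mem_gridCell (fun k : ℕ => (prm.θhi : ℝ) * k / prm.nθ) (prm.nθ - 1)
    (Δ := θ) (by simpa using hθ0) (by
      show θ ≤ (prm.θhi : ℝ) * ((prm.nθ - 1 + 1 : ℕ) : ℝ) / prm.nθ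
      rw [hn1, mul_div_assoc, div_self hnR.ne', mul_one]; exact hθ1)
  have hk1' : (prm.θhi : ℝ) * k / prm.nθ ≤ θ := hk1
  have hk2' : θ ≤ (prm.θhi : ℝ) * ((k : ℝ) + 1) / prm.nθ := by
    have : θ ≤ (prm.θhi : ℝ) * ((k + 1 : ℕ) : ℝ) / prm.nθ := hk2
    push_cast at this; exact this
  have hkn : k < prm.nθ := by omega
  have hcell := List.all_eq_true.mp hall k (List.mem_range.mpr hkn)
  simp only [cellOK, Bool.and_eq_true, Bool.or_eq_true, decide_eq_true_eq] at hcell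
  obtain ⟨htail, hbox⟩ := hcell
  have hid1 : (prm.θhi : ℝ) * (2 * (k : ℝ) + 1) / (2 * prm.nθ) - prm.θhi / (2 * prm.nθ) =
      (prm.θhi : ℝ) * k / prm.nθ := by field_simp; ring
  have hid2 : (prm.θhi : ℝ) * (2 * (k : ℝ) + 1) / (2 * prm.nθ) + prm.θhi / (2 * prm.nθ) =
      (prm.θhi : ℝ) * ((k : ℝ) + 1) / prm.nθ := by field_simp; ring
  have hc : |θ - ((prm.θhi * (2 * (k : ℚ) + 1) / (2 * (prm.nθ : ℚ)) : ℚ) : ℝ)| ≤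
      ((prm.θhi / (2 * (prm.nθ : ℚ)) : ℚ) : ℝ) := by
    push_cast; rw [abs_le]; constructor <;> linarith
  have hh0 : (0 : ℚ) ≤ prm.θhi / (2 * (prm.nθ : ℚ)) := by
    have : (0 : ℚ) < prm.nθ := by exact_mod_cast hn
    positivity
  have hpm := pmem_colEncl hS hG M hh0 hc
  have hcv : evalR (colVals G M θ) P = eval2 G P θ := evalR_colVals_eff hS hG hsz P θ
  rw [← hcv]
  by_cases hPP : (prm.P1 : ℝ) ≤ P
  · -- unbounded part: shift to P₁, signs
    have hsh := pmem_shiftI hS (mem_ofRat S prm.P1) hpm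
    have hpos := evalR_pos_of_posLead hS hsh htail (y := P - prm.P1) (by linarith)
    rwa [evalR_shiftR, show (prm.P1 : ℝ) + (P - prm.P1) = P by ring] at hpos
  · have hlt : P < (prm.P1 : ℝ) := lt_of_not_ge hPP
    rcases hbox with hvac | hposk
    · exact absurd ((show ((prm.P1 : ℚ) : ℝ) ≤ (P0 : ℝ) by exact_mod_cast hvac).trans hP) hPP
    · have hP0P1 : P0 ≤ prm.P1 := by
        have : (P0 : ℝ) ≤ prm.P1 := hP.trans hlt.le
        exact_mod_cast this
      exact posOn_sound hS hposk hP0P1 hpm hP hlt.le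

end Summit.CriticalPhenomena.Ising3D
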